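import Summits.BirchSwinnertonDyer.BirchSwinnertonDyer.Theorems.ConjSpanGenAllLevels
import HarnessLib

/-!
# Stub 1b of LINE `theoremB-x10b` (crux `PrintX10b.AnalyticMuZeroX10b`, stmt-BirchSwinnertonDyer-20682):
# THEOREM B from Vaserstein's relative elementary theorem over `ℤ[1/m]`

`stub_theoremB_of_vasersteinAway` (registered skeleton sha16 41c1930e4741df0b, lead prover p1 of cell bsd-f3-mu), by
NAME and VERBATIM signature: (V) «`G(eA, A) ≤ E(eA, A)` for `A = ℤ[1/m]`, `m ≥ 2`, `e ≥ 1`» ⟹ THEOREM B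
«`ConjSpanGen N p` for every level `N` and every prime `p ∤ N`» (the cyclotomic winding classes `{0 → a/pⁿ}` span
`pr Γ_H(N)`, `H = ⟨−1, p⟩`).  The proof is the tree theorem
`Summit.BirchSwinnertonDyer.BirchSwinnertonDyer.Theorems.ConjSpanGenAllLevels.conjSpanGenAll_of_vaserstein_away`
(mathematics and kernel text: bsd-f3-mu seat -an g4/g5, MEMO-an §13 — orbit trick in `SL₂(ℤ[1/p])`,
`Δ = Γ₀(N)·B⁺ = Γ₀(N)·B⁻_N`, transpose bridge; landed in three files by bsd-print-x8 seat p4, p569503/p570691/p571570).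
Nothing else is in this file.
-/

namespace Summit.BirchSwinnertonDyer.BirchSwinnertonDyer.Cruxes.AnalyticMuZeroX10b.TheoremB

-- `Summit.<Summit>.<Sub>.…` with Summit = Sub (D-0017): the linter flags it by design
set_option linter.dupNamespace false

open Literature.NumberTheory.EllipticCurves.Rank1Residual

/-- **Stub 1b of LINE `theoremB-x10b`**: Vaserstein's `G(eℤ[1/m], ℤ[1/m]) ≤ E(eℤ[1/m], ℤ[1/m])` (`m ≥ 2`, `e ≠ 0`)
implies THEOREM B, `ConjSpanGen N p` for all levels `N` and primes `p ∤ N` (cell bsd-f3-mu, MEMO-an §13;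
tree theorem `ConjSpanGenAllLevels.conjSpanGenAll_of_vaserstein_away`). [folklore] -/
theorem stub_theoremB_of_vasersteinAway :
    (∀ (m : ℕ), 2 ≤ m → ∀ e : ℕ, e ≠ 0 →
      Literature.NumberTheory.Automorphic.SL2Rel.relG (Ideal.span {(e : Localization.Away (m : ℤ))}) ⊤ ≤
        Literature.NumberTheory.Automorphic.SL2Rel.relE (Ideal.span {(e : Localization.Away (m : ℤ))})
          (⊤ : Ideal (Localization.Away (m : ℤ)))) →
      ∀ (N p : ℕ), p.Prime → ¬ p ∣ N → ConjSpanGen N p :=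
  fun h => Summit.BirchSwinnertonDyer.BirchSwinnertonDyer.Theorems.ConjSpanGenAllLevels.conjSpanGenAll_of_vaserstein_away h

end Summit.BirchSwinnertonDyer.BirchSwinnertonDyer.Cruxes.AnalyticMuZeroX10b.TheoremB
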